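import Mathlib
import HarnessLib
import Literature.Computability.AlgebraicComplexity.ArithCircuit
import Literature.Computability.AlgebraicComplexity.CircuitDepth
import Literature.Computability.AlgebraicComplexity.StandardFamilies
import Literature.Computability.AlgebraicComplexity.DeterminantalIdealComplexityDescent
import Literature.Computability.AlgebraicComplexity.RealTauConjectureDepthFour
import Literature.Computability.AlgebraicComplexity.AndrewsForbes2022BorderComposition
import Literature.Computability.AlgebraicComplexity.ArithCircuitProjections
import Literature.Computability.AlgebraicComplexity.DepthThreeChasmCircuits
import Literature.GroupTheory.ArithmeticGroups.SelbergLemma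
import Summits.ValiantsHypothesis.Statement
import Summits.ValiantsHypothesis.ValiantsHypothesis.Theorems.SuccinctLiftAlgebraicConstants
import Summits.ValiantsHypothesis.ValiantsHypothesis.Theorems.SuccinctLiftIntegerAdvice
import Summits.ValiantsHypothesis.ValiantsHypothesis.Theorems.DepthWindowHalf

/-!
# SuccinctLift — the CHARACTERISTIC coordinate of wall K (finite fields; w6/w7 of generation 5)

Route `route-ValiantsHypothesis-SuccinctLift` (lens 2 of the Valiant decomposition workshop) factors
`PerHardLog3` (no `n^c + c`-wire circuits of product-depth `Δ₁(n) = ⌊log₂⌊log₂⌊log₂ n⌋⌋⌋ + 1` for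
the permanent over `ℂ`) through the constant dial
`D0 (sign constants) → D1 (poly-height integer advice) → D2 (integer advice) → Dℂ ≃ Dtop (Q̄)` of
`SuccinctLiftIntegerAdvice.lean`.  This file adds the coordinate the dial was missing — the
CHARACTERISTIC — and proves, in the kernel, the two transfer theorems that place it:

* §1 `exists_ringHom_finiteField_natCast_ne_zero`: a finitely generated subring of `ℂ` maps onto a
  FINITE field in which a prescribed integer `N ≠ 0` stays non-zero (a maximal ideal of `A[1/N]`;
  the residue field is finite because `ℤ` is Jacobson — the tree's
  `Literature.GroupTheory.ArithmeticGroups.finite_quotient_of_isMaximal`).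
* §2 `exists_finiteFieldConstants` (**skeleton-exact reduction to positive characteristic**): a
  complex circuit computing an integer polynomial `f` can be replaced, for every `N ≠ 0`, by a
  circuit with the SAME gates / wires / product-depth / size over some finite field `F` with
  `(N : F) ≠ 0`, computing `f` over `F` (restrict the constants to `A = ℤ[consts] ⊆ ℂ` with
  `ArithCircuit.mapConsts`, then specialise along `A → F`).  Bürgisser 2000, §4.1 ("independence of
  the characteristic, one direction"), made skeleton-exact.
* §3 The finite-field dial points `PerEasyMod p Δ` (prime field `𝔽_p`), `PerEasyEveryPrime Δ`
  (one exponent `c` serving every prime) and the hardness statement `PerHardCofiniteChar Δ` (for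
  every `c` some `per_n` is hard over EVERY finite field of characteristic prime to some `N ≠ 0`,
  i.e. over all finite fields of all but finitely many characteristics), with the kernel arrows
  `PerHardCofiniteChar Δ → ¬ PerEasyComplex Δ` (`not_perEasyComplex_of_perHardCofiniteChar`, by §2),
  `PerHardCofiniteChar Δ → ¬ PerEasyEveryPrime Δ` (a prime `p > N`),
  `PerEasyIntAdv Δ → PerEasyEveryPrime Δ` (an integer advice circuit reduces modulo every `p`:
  `exists_computes_perPoly_of_intCircuit`), hence `¬ PerEasyEveryPrime Δ → ¬ PerEasyIntAdv Δ`, which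
  discharges the route's split child `HeightLiftAt Δ` (and the hypothesis of `AlgDescentAt Δ`)
  from hardness modulo ONE prime per exponent (`heightLiftAt_of_not_perEasyEveryPrime`; item form
  `heightLiftLog3_of_perHardSomePrime`).  The converse arrows (`¬ PerEasyComplex Δ →
  PerHardCofiniteChar Δ`, Hilbert's Nullstellensatz / compactness; necessity of
  `¬ PerEasyEveryPrime Δ₁` for `VP ≠ VNP`) are PRINT facts (Bürgisser 2000, §4.1) and are not used.
* §4 (critic request w6) lens 4's below-one-half rung `DepthWindow.perHardBelowHalf` (every slope
  `κ = p/q < 1/2`, arbitrary complex constants) decides the WHOLE constant dial below one half: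
  `¬ PerEasyAlg`, `¬ PerEasyIntAdv`, `¬ PerEasyPolyAdv`, `¬ PerEasyCF`, and the walls
  `AlgConstantLiftAt`, `HeightLiftAt`, `AlgDescentAt` all HOLD at `Δ = ⌊p·L₃/q⌋`, `2p < q`; the open
  window of every wall of this route is exactly the slope interval `[1/2, 1]` of lens 4.

Everything here is unconditional, sorry-free and definition-light (three `Prop` abbreviations of
dial points); nothing in this file bears on `VP ≠ VNP` itself.

References: Burgisser2000 (§4.1, Prop. 4.1); KoiranPerifel2011 (§2); LimayeSrinivasanTavenas2025
(Cor. 4); Forbes2024 (CCC 2024, low-depth lower bounds over all fields — print context only).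
-/

namespace Summit.ValiantsHypothesis.ValiantsHypothesis.Theorems.SuccinctLift

open Literature.Computability.AlgebraicComplexity MvPolynomial

/-! ### §1 Finite residue fields of finitely generated subrings of `ℂ`, avoiding `N` -/

/-- A finitely generated `ℤ`-algebra which is a domain of characteristic `0` admits a ring
homomorphism to a FINITE FIELD in which a prescribed `N ≠ 0` stays non-zero: a maximal ideal of
`A[1/N]` has finite residue field (Zariski's lemma over the Jacobson ring `ℤ`), and `N` is a unit
there. [cite: Burgisser2000, §4.1] -/
theorem exists_ringHom_finiteField_natCast_ne_zero (A : Type) [CommRing A] [IsDomain A]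
    [CharZero A] [Algebra ℤ A] [Algebra.FiniteType ℤ A] (N : ℕ) (hN : N ≠ 0) :
    ∃ (F : Type) (_ : Field F) (_ : Fintype F) (_ : A →+* F), (N : F) ≠ 0 := by
  have hN0 : (N : A) ≠ 0 := Nat.cast_ne_zero.mpr hN
  let A' := Localization.Away (N : A)
  have hinjA : Function.Injective (algebraMap A A') :=
    IsLocalization.injective A' (powers_le_nonZeroDivisors_of_noZeroDivisors hN0)
  haveI : Nontrivial A' := hinjA.nontrivial
  obtain ⟨M', hM'⟩ := Ideal.exists_maximal A'
  haveI : Finite (A' ⧸ M') :=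
    Literature.GroupTheory.ArithmeticGroups.finite_quotient_of_isMaximal M'
  letI : Field (A' ⧸ M') := Ideal.Quotient.field M'
  letI : Fintype (A' ⧸ M') := Fintype.ofFinite _
  -- `N` is a unit in `A' = A[1/N]`, hence non-zero in the (non-trivial) residue field `A'/M'`
  have hunit : IsUnit ((N : ℕ) : A' ⧸ M') := by
    have h := (IsLocalization.Away.algebraMap_isUnit (S := A') (N : A)).map (Ideal.Quotient.mk M')
    rwa [map_natCast, map_natCast] at h
  exact ⟨A' ⧸ M', inferInstance, inferInstance, (Ideal.Quotient.mk M').comp (algebraMap A A'),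
    hunit.ne_zero⟩

/-! ### §2 Skeleton-exact reduction of a complex circuit to a finite field -/

/-- **Finite-field constants suffice at a fixed skeleton, away from any `N ≠ 0`**
(Bürgisser 2000, §4.1, skeleton-exact form, positive-characteristic half): a complex arithmetic
circuit computing (the image of) an INTEGER polynomial `f` can be replaced, for every `N ≠ 0`, by a
circuit over some finite field `F` with `(N : F) ≠ 0`, with the same product-depth, the same edge
size and the same size, computing `f` over `F`.  Proof: the finitely many constants of `C` generate
a subring `A = ℤ[consts C] ⊆ ℂ` (a finitely generated domain of characteristic `0`); restricting the
constants to `A` (`ArithCircuit.mapConsts`) gives a circuit over `A` computing `f` (change of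
scalars along the injection `A ⊆ ℂ`), and specialising along a ring map `A → F` of §1 gives the
circuit over `F`. [cite: Burgisser2000, §4.1] -/
theorem exists_finiteFieldConstants {σ : Type*} (C : ArithCircuit ℂ σ) (f : MvPolynomial σ ℤ)
    (hC : C.Computes (MvPolynomial.map (Int.castRingHom ℂ) f)) (N : ℕ) (hN : N ≠ 0) :
    ∃ (F : Type) (_ : Field F) (_ : Fintype F), (N : F) ≠ 0 ∧ ∃ C' : ArithCircuit F σ,
      C'.Computes (MvPolynomial.map (Int.castRingHom F) f) ∧
      C'.productDepth = C.productDepth ∧ C'.edgeSize = C.edgeSize ∧ C'.size = C.size := by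
  classical
  -- Step 1: restrict the constants of `C` to `A = ℤ[consts C] ⊆ ℂ`.
  let S : Finset ℂ := C.consts.toFinset
  let A : Subalgebra ℤ ℂ := Algebra.adjoin ℤ (S : Set ℂ)
  haveI : Algebra.FiniteType ℤ A :=
    (Subalgebra.fg_iff_finiteType A).mp (Subalgebra.fg_adjoin_finset S)
  let ρ : ℂ → A := fun z => if h : z ∈ (S : Set ℂ) then ⟨z, Algebra.subset_adjoin h⟩ else 0
  let ι : A →+* ℂ := (A.val : A →ₐ[ℤ] ℂ).toRingHom
  have hι : Function.Injective ι := Subtype.val_injective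
  let CA : ArithCircuit A σ := C.mapConsts ρ
  have hfix : ∀ c ∈ C.consts, ι (ρ c) = c := by
    intro c hc
    have hcS : c ∈ (S : Set ℂ) := Finset.mem_coe.mpr (List.mem_toFinset.mpr hc)
    simp only [ρ, dif_pos hcS]
    rfl
  have hCA : CA.map ι = C := ArithCircuit.map_mapConsts_eq_self ρ ι C hfix
  have hevA : CA.eval = MvPolynomial.map (Int.castRingHom A) f := by
    refine MvPolynomial.map_injective ι hι ?_
    rw [← ArithCircuit.eval_map_apply, hCA, MvPolynomial.map_map,
      Subsingleton.elim (ι.comp (Int.castRingHom A)) (Int.castRingHom ℂ)]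
    exact hC
  -- Step 2: specialise along `A → F`, `F` a finite field with `(N : F) ≠ 0`.
  obtain ⟨F, instF, instFin, θ, hNF⟩ := exists_ringHom_finiteField_natCast_ne_zero A N hN
  refine ⟨F, instF, instFin, hNF, CA.map θ, ?_, ?_, ?_, ?_⟩
  · show (CA.map θ).eval = _
    rw [ArithCircuit.eval_map_apply, hevA, MvPolynomial.map_map,
      Subsingleton.elim (θ.comp (Int.castRingHom A)) (Int.castRingHom F)]
  · rw [ArithCircuit.productDepth_mapCoeff]
    conv_rhs => rw [← hCA]
    exact (ArithCircuit.productDepth_mapCoeff ι CA).symm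
  · rw [ArithCircuit.edgeSize_mapCoeff]
    conv_rhs => rw [← hCA]
    exact (ArithCircuit.edgeSize_mapCoeff ι CA).symm
  · rw [ArithCircuit.size_map]
    conv_rhs => rw [← hCA]
    exact (ArithCircuit.size_map ι CA).symm

/-- The permanent case of `exists_finiteFieldConstants`: a complex circuit for `per_n` yields, for
every `N ≠ 0`, a circuit with the same skeleton for `per_n` over a finite field `F` with
`(N : F) ≠ 0`. [cite: Burgisser2000, §4.1] -/
theorem exists_finiteField_computes_perPoly {n : ℕ} (C : ArithCircuit ℂ (Fin n × Fin n))
    (hC : C.Computes (perPoly (Fin n) ℂ)) (N : ℕ) (hN : N ≠ 0) :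
    ∃ (F : Type) (_ : Field F) (_ : Fintype F), (N : F) ≠ 0 ∧
      ∃ C' : ArithCircuit F (Fin n × Fin n), C'.Computes (perPoly (Fin n) F) ∧
        C'.productDepth = C.productDepth ∧ C'.edgeSize = C.edgeSize := by
  obtain ⟨F, instF, instFin, hNF, C', hC', hd, hs, -⟩ :=
    exists_finiteFieldConstants C (perPoly (Fin n) ℤ) (by rwa [map_perPoly]) N hN
  exact ⟨F, instF, instFin, hNF, C', by rwa [map_perPoly] at hC', hd, hs⟩

/-! ### §3 The characteristic coordinate of the dial -/

/-- Dial point `D_p`: per has `n^c + c`-wire, depth-`Δ(n)` circuits over the prime field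
`𝔽_p = ZMod p` (constants: finitely many field elements — no constant wall).
[cite: Burgisser2000, §4.1] -/
def PerEasyMod (p : ℕ) (Δ : ℕ → ℕ) : Prop :=
  ∃ c : ℕ, ∀ n : ℕ, ∃ C : ArithCircuit (ZMod p) (Fin n × Fin n),
    C.Computes (perPoly (Fin n) (ZMod p)) ∧ C.productDepth ≤ Δ n ∧ C.edgeSize ≤ n ^ c + c

/-- Dial point `D_∀p`: ONE exponent `c` such that per has `n^c + c`-wire, depth-`Δ(n)` circuits
over `𝔽_p` for every `n` and every prime `p`.  Its negation — "for every `c` some `per_n` is hard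
modulo SOME prime" — is the road `P` of the route header (w7). [cite: Burgisser2000, §4.1] -/
def PerEasyEveryPrime (Δ : ℕ → ℕ) : Prop :=
  ∃ c : ℕ, ∀ n p : ℕ, p.Prime → ∃ C : ArithCircuit (ZMod p) (Fin n × Fin n),
    C.Computes (perPoly (Fin n) (ZMod p)) ∧ C.productDepth ≤ Δ n ∧ C.edgeSize ≤ n ^ c + c

/-- **Hardness in cofinitely many characteristics** (`P^cof`): for every exponent `c` there are
`n` and `N ≠ 0` such that `per_n` has no `n^c + c`-wire, depth-`Δ(n)` circuit over ANY finite field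
in which `N ≠ 0` — i.e. over all finite fields of all characteristics not dividing `N`.
[cite: Burgisser2000, §4.1] -/
def PerHardCofiniteChar (Δ : ℕ → ℕ) : Prop :=
  ∀ c : ℕ, ∃ n N : ℕ, N ≠ 0 ∧ ∀ (F : Type) [Field F] [Fintype F], (N : F) ≠ 0 →
    ¬ ∃ C : ArithCircuit F (Fin n × Fin n),
      C.Computes (perPoly (Fin n) F) ∧ C.productDepth ≤ Δ n ∧ C.edgeSize ≤ n ^ c + c

/-- **TRANSFER (kernel half of "independence of the characteristic")**: hardness of the permanent
at a fixed wire/depth budget over all finite fields of cofinitely many characteristics implies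
hardness over `ℂ` against ARBITRARY complex constants (contrapositive of
`exists_finiteField_computes_perPoly`). [cite: Burgisser2000, §4.1] -/
theorem not_perEasyComplex_of_perHardCofiniteChar (Δ : ℕ → ℕ) (h : PerHardCofiniteChar Δ) :
    ¬ PerEasyComplex Δ := by
  rintro ⟨c, hc⟩
  obtain ⟨n, N, hN, hF⟩ := h c
  obtain ⟨C, hC, hd, hs⟩ := hc n
  obtain ⟨F, instF, instFin, hNF, C', hC', hd', hs'⟩ := exists_finiteField_computes_perPoly C hC N hN
  exact hF F hNF ⟨C', hC', hd' ▸ hd, hs' ▸ hs⟩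

/-- `P^cof ⟹ ¬ PerEasyAlg` (same budget, constants in `algebraicClosure ℚ ℂ`).
[cite: Burgisser2000, §4.1] -/
theorem not_perEasyAlg_of_perHardCofiniteChar (Δ : ℕ → ℕ) (h : PerHardCofiniteChar Δ) :
    ¬ PerEasyAlg Δ :=
  fun hA => not_perEasyComplex_of_perHardCofiniteChar Δ h ((perEasyComplex_iff_perEasyAlg Δ).mpr hA)

/-- `P^cof ⟹ P`: hardness in cofinitely many characteristics gives, for every `c`, a prime `p`
(any prime above `N`) modulo which `per_n` is hard over the prime field. [cite: Burgisser2000, §4.1] -/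
theorem not_perEasyEveryPrime_of_perHardCofiniteChar (Δ : ℕ → ℕ) (h : PerHardCofiniteChar Δ) :
    ¬ PerEasyEveryPrime Δ := by
  rintro ⟨c, hc⟩
  obtain ⟨n, N, hN, hF⟩ := h c
  obtain ⟨p, hNp, hp⟩ := Nat.exists_infinite_primes (N + 1)
  haveI : Fact p.Prime := ⟨hp⟩
  have hNF : (N : ZMod p) ≠ 0 := by
    rw [Ne, ZMod.natCast_eq_zero_iff]
    exact Nat.not_dvd_of_pos_of_lt (Nat.pos_of_ne_zero hN) (Nat.lt_of_succ_le hNp)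
  exact hF (ZMod p) hNF (hc n p hp)

/-- **Reduction of an integer advice circuit to any commutative ring** (skeleton-exact): if the
complex circuit `C'` obtained from a sign circuit `C` with integer advice `a` computes `per_n`, then
over every commutative ring `R` the same skeleton computes `per_n` (the integer identity
`C[a].eval = per_n` holds in `ℤ[x]` because `ℤ[x] → ℂ[x]` is injective, and maps to `R[x]`).
[cite: KoiranPerifel2011, §2] -/
theorem exists_computes_perPoly_of_intCircuit {n m : ℕ} (a : Fin m → ℤ)
    (C : ArithCircuit ℤ (Fin (n * n) ⊕ Fin m)) (C' : ArithCircuit ℂ (Fin n × Fin n))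
    (hC' : C' = ((C.substVC (Sum.elim Sum.inl fun i => Sum.inr (a i))).map (Int.castRingHom ℂ)).rename
      ⇑(finProdFinEquiv (m := n) (n := n)).symm)
    (hper : C'.Computes (perPoly (Fin n) ℂ)) (R : Type) [CommRing R] :
    ∃ D : ArithCircuit R (Fin n × Fin n), D.Computes (perPoly (Fin n) R) ∧
      D.productDepth = C'.productDepth ∧ D.edgeSize = C'.edgeSize := by
  set E : ArithCircuit ℤ (Fin (n * n)) := C.substVC (Sum.elim Sum.inl fun i => Sum.inr (a i))
    with hE
  have hEZ : (E.rename ⇑(finProdFinEquiv (m := n) (n := n)).symm).eval = perPoly (Fin n) ℤ := by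
    refine MvPolynomial.map_injective (Int.castRingHom ℂ) Int.cast_injective ?_
    rw [ArithCircuit.eval_rename_apply, MvPolynomial.map_rename, ← ArithCircuit.eval_map_apply,
      ← ArithCircuit.eval_rename_apply, ← hC', map_perPoly]
    exact hper
  refine ⟨(E.map (Int.castRingHom R)).rename ⇑(finProdFinEquiv (m := n) (n := n)).symm, ?_, ?_, ?_⟩
  · show ((E.map (Int.castRingHom R)).rename _).eval = _
    rw [ArithCircuit.eval_rename_apply, ArithCircuit.eval_map_apply, ← MvPolynomial.map_rename,
      ← ArithCircuit.eval_rename_apply, hEZ, map_perPoly]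
  · rw [hC', DepthThreeChasm.productDepth_rename, DepthThreeChasm.productDepth_rename,
      ArithCircuit.productDepth_mapCoeff, ArithCircuit.productDepth_mapCoeff]
  · rw [hC', DepthThreeChasm.edgeSize_rename, DepthThreeChasm.edgeSize_rename,
      ArithCircuit.edgeSize_mapCoeff, ArithCircuit.edgeSize_mapCoeff]

/-- Dial monotonicity `D2 ⟹ D_∀p` (uniformly in `p`): an integer-advice family reduces modulo
every prime with the same exponent. [cite: KoiranPerifel2011, §2] -/
theorem perEasyEveryPrime_of_perEasyIntAdv (Δ : ℕ → ℕ) (h : PerEasyIntAdv Δ) :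
    PerEasyEveryPrime Δ := by
  obtain ⟨c, hc⟩ := h
  refine ⟨c, fun n p _ => ?_⟩
  obtain ⟨m, -, a, C, -, C', hC', hper, hd, hw⟩ := hc n
  obtain ⟨D, hD, hdD, hsD⟩ := exists_computes_perPoly_of_intCircuit a C C' hC' hper (ZMod p)
  exact ⟨D, hD, hdD ▸ hd, hsD ▸ hw⟩

/-- Dial monotonicity `D2 ⟹ D_p` for every modulus `p`. [cite: KoiranPerifel2011, §2] -/
theorem perEasyMod_of_perEasyIntAdv (p : ℕ) (Δ : ℕ → ℕ) (h : PerEasyIntAdv Δ) :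
    PerEasyMod p Δ := by
  obtain ⟨c, hc⟩ := h
  refine ⟨c, fun n => ?_⟩
  obtain ⟨m, -, a, C, -, C', hC', hper, hd, hw⟩ := hc n
  obtain ⟨D, hD, hdD, hsD⟩ := exists_computes_perPoly_of_intCircuit a C C' hC' hper (ZMod p)
  exact ⟨D, hD, hdD ▸ hd, hsD ▸ hw⟩

/-- `D_∀p ⟹ D_p` for `p` prime. [cite: Burgisser2000, §4.1] -/
theorem perEasyMod_of_perEasyEveryPrime {p : ℕ} (hp : p.Prime) (Δ : ℕ → ℕ)
    (h : PerEasyEveryPrime Δ) : PerEasyMod p Δ := by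
  obtain ⟨c, hc⟩ := h
  exact ⟨c, fun n => hc n p hp⟩

/-- **ROAD `P` (w7), kernel part: hardness modulo one prime per exponent implies integer-advice
hardness of EVERY height** (`¬ D_∀p ⟹ ¬ D2`). [cite: KoiranPerifel2011, §2] -/
theorem not_perEasyIntAdv_of_not_perEasyEveryPrime (Δ : ℕ → ℕ) (h : ¬ PerEasyEveryPrime Δ) :
    ¬ PerEasyIntAdv Δ :=
  fun hI => h (perEasyEveryPrime_of_perEasyIntAdv Δ hI)

/-- `¬ D_∀p ⟹ ¬ D1`. [cite: KoiranPerifel2011, §2] -/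
theorem not_perEasyPolyAdv_of_not_perEasyEveryPrime (Δ : ℕ → ℕ) (h : ¬ PerEasyEveryPrime Δ) :
    ¬ PerEasyPolyAdv Δ :=
  fun hP => not_perEasyIntAdv_of_not_perEasyEveryPrime Δ h (perEasyIntAdv_of_perEasyPolyAdv Δ hP)

/-- `¬ D_∀p ⟹ ¬ D0` (hardness modulo one prime per exponent implies CONSTANT-FREE hardness, the
output `PerHardLog3CF` of walls A and U). [cite: KoiranPerifel2011, §2] -/
theorem not_perEasyCF_of_not_perEasyEveryPrime (Δ : ℕ → ℕ) (h : ¬ PerEasyEveryPrime Δ) :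
    ¬ PerEasyCF Δ :=
  fun hC => not_perEasyPolyAdv_of_not_perEasyEveryPrime Δ h (perEasyPolyAdv_of_perEasyCF Δ hC)

/-- **`P ⟹ H`**: hardness modulo one prime per exponent discharges the height lift `HeightLiftAt Δ`
(its conclusion `¬ D2` holds outright). [cite: KoiranPerifel2011, §2] -/
theorem heightLiftAt_of_not_perEasyEveryPrime (Δ : ℕ → ℕ) (h : ¬ PerEasyEveryPrime Δ) :
    HeightLiftAt Δ :=
  fun _ => not_perEasyIntAdv_of_not_perEasyEveryPrime Δ h

/-- `P^cof` discharges all three walls of the constant dial at `Δ` (`K_alg`, `H`, `D`).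
[cite: Burgisser2000, §4.1] -/
theorem algConstantLiftAt_of_perHardCofiniteChar (Δ : ℕ → ℕ) (h : PerHardCofiniteChar Δ) :
    AlgConstantLiftAt Δ ∧ HeightLiftAt Δ ∧ AlgDescentAt Δ :=
  ⟨fun _ => not_perEasyAlg_of_perHardCofiniteChar Δ h,
    heightLiftAt_of_perHardAlg Δ (not_perEasyAlg_of_perHardCofiniteChar Δ h),
    algDescentAt_of_perHardAlg Δ (not_perEasyAlg_of_perHardCofiniteChar Δ h)⟩

/-- **Registered-stub form of `P ⟹ H`** on the route item `HeightLiftLog3` (stmt 23720,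
`Δ₁(n) = ⌊log₂⌊log₂⌊log₂ n⌋⌋⌋ + 1`): hardness of `per` modulo one prime per exponent at depth `Δ₁`
implies the height lift. [cite: KoiranPerifel2011, §2] -/
theorem heightLiftLog3_of_perHardSomePrime : ¬ PerEasyEveryPrime (fun n => Nat.log 2 (Nat.log 2 (Nat.log 2 n)) + 1) → HeightLiftAt (fun n => Nat.log 2 (Nat.log 2 (Nat.log 2 n)) + 1) :=
  heightLiftAt_of_not_perEasyEveryPrime _

/-- **Item form of `P ⟹ H`, literal**: "for every `c` some `per_n` has no `n^c + c`-wire,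
product-depth-`Δ₁(n)` circuit over some prime field `𝔽_p`" implies the literal statement of the
route item `HeightLiftLog3` (stmt 23720) — indeed its conclusion. [cite: KoiranPerifel2011, §2] -/
theorem heightLiftLog3_literal_of_perHardSomePrime
    (h : ¬ ∃ c : ℕ, ∀ n p : ℕ, p.Prime → ∃ C : ArithCircuit (ZMod p) (Fin n × Fin n),
      C.Computes (perPoly (Fin n) (ZMod p)) ∧
        C.productDepth ≤ Nat.log 2 (Nat.log 2 (Nat.log 2 n)) + 1 ∧ C.edgeSize ≤ n ^ c + c) :
    (¬ ∃ c : ℕ, ∀ n : ℕ, ∃ m : ℕ, m ≤ n ^ c + c ∧ ∃ a : Fin m → ℤ, (∀ i, (a i).natAbs ≤ 2 ^ (n ^ c + c)) ∧ ∃ C : Literature.Computability.AlgebraicComplexity.ArithCircuit ℤ (Fin (n * n) ⊕ Fin m), C.HasSignConstants ∧ ∃ C' : Literature.Computability.AlgebraicComplexity.ArithCircuit ℂ (Fin n × Fin n), C' = ((C.substVC (Sum.elim Sum.inl fun i => Sum.inr (a i))).map (Int.castRingHom ℂ)).rename ⇑(finProdFinEquiv (m := n) (n := n)).symm ∧ C'.Computes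 (Literature.Computability.AlgebraicComplexity.perPoly (Fin n) ℂ) ∧ C'.productDepth ≤ Nat.log 2 (Nat.log 2 (Nat.log 2 n)) + 1 ∧ C'.edgeSize ≤ n ^ c + c) → ¬ ∃ c : ℕ, ∀ n : ℕ, ∃ m : ℕ, m ≤ n ^ c + c ∧ ∃ a : Fin m → ℤ, ∃ C : Literature.Computability.AlgebraicComplexity.ArithCircuit ℤ (Fin (n * n) ⊕ Fin m), C.HasSignConstants ∧ ∃ C' : Literature.Computability.AlgebraicComplexity.ArithCircuit ℂ (Fin n × Fin n), C' = ((C.substVC (Sum.elim Sum.inl fun i => Sum.inr (a i))).map (Int.castRingHom ℂ)).rename ⇑(finProdFinEquiv (m := n) (n := n)).symm ∧ C'.Computes (Literature.Computability.AlgebraicComplexity.perPoly (Fin n) ℂ) ∧ C'.productDepth ≤ Nat.log 2 (Nat.log 2 (Nat.log 2 n)) + 1 ∧ C'.edgeSize ≤ n ^ c + c :=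
  heightLiftAt_of_not_perEasyEveryPrime (fun n => Nat.log 2 (Nat.log 2 (Nat.log 2 n)) + 1) h

/-- **Item form of the transfer `P^cof ⟹ PerHardLog3`** (lens 4's crux, arbitrary complex constants,
`Δ₁`). [cite: Burgisser2000, §4.1] -/
theorem perHardLog3_of_perHardCofiniteChar
    (h : PerHardCofiniteChar fun n => Nat.log 2 (Nat.log 2 (Nat.log 2 n)) + 1) :
    ¬ ∃ c : ℕ, ∀ n : ℕ, ∃ C : ArithCircuit ℂ (Fin n × Fin n), C.Computes (perPoly (Fin n) ℂ) ∧
      C.productDepth ≤ Nat.log 2 (Nat.log 2 (Nat.log 2 n)) + 1 ∧ C.edgeSize ≤ n ^ c + c :=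
  not_perEasyComplex_of_perHardCofiniteChar _ h

/-! ### §4 (w6) Below one half the whole dial is decided: every wall holds at slopes `κ < 1/2` -/

/-- Lens 4's rung read on the dial: at `Δ = ⌊p · L₃ / q⌋`, `2p < q`, per is HARD over `ℂ` against
arbitrary constants (`DepthWindow.perHardBelowHalf`). [cite: LimayeSrinivasanTavenas2025, Cor. 4] -/
theorem not_perEasyComplex_belowHalf (p q : ℕ) (hpq : 2 * p < q) :
    ¬ PerEasyComplex fun n => p * Nat.log 2 (Nat.log 2 (Nat.log 2 n)) / q :=
  DepthWindow.perHardBelowHalf p q hpq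

/-- … hence HARD against constants in `algebraicClosure ℚ ℂ`. [cite: LimayeSrinivasanTavenas2025, Cor. 4] -/
theorem not_perEasyAlg_belowHalf (p q : ℕ) (hpq : 2 * p < q) :
    ¬ PerEasyAlg fun n => p * Nat.log 2 (Nat.log 2 (Nat.log 2 n)) / q :=
  fun h => not_perEasyComplex_belowHalf p q hpq ((perEasyComplex_iff_perEasyAlg _).mpr h)

/-- … hence HARD against integer advice of any height (`¬ D2`). [cite: LimayeSrinivasanTavenas2025, Cor. 4] -/
theorem not_perEasyIntAdv_belowHalf (p q : ℕ) (hpq : 2 * p < q) :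
    ¬ PerEasyIntAdv fun n => p * Nat.log 2 (Nat.log 2 (Nat.log 2 n)) / q :=
  fun h => not_perEasyComplex_belowHalf p q hpq (perEasyComplex_of_perEasyIntAdv _ h)

/-- … hence HARD against polynomial-height integer advice (`¬ D1`). [cite: LimayeSrinivasanTavenas2025, Cor. 4] -/
theorem not_perEasyPolyAdv_belowHalf (p q : ℕ) (hpq : 2 * p < q) :
    ¬ PerEasyPolyAdv fun n => p * Nat.log 2 (Nat.log 2 (Nat.log 2 n)) / q :=
  fun h => not_perEasyIntAdv_belowHalf p q hpq (perEasyIntAdv_of_perEasyPolyAdv _ h)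

/-- … hence constant-free HARD (`¬ D0`). [cite: LimayeSrinivasanTavenas2025, Cor. 4] -/
theorem not_perEasyCF_belowHalf (p q : ℕ) (hpq : 2 * p < q) :
    ¬ PerEasyCF fun n => p * Nat.log 2 (Nat.log 2 (Nat.log 2 n)) / q :=
  fun h => not_perEasyPolyAdv_belowHalf p q hpq (perEasyPolyAdv_of_perEasyCF _ h)

/-- **w6: the three walls `K_alg`, `H`, `D` of the route all HOLD at every slope `κ = p/q < 1/2`**
(one-line corollaries of lens 4's `perHardBelowHalf` via `heightLiftAt_of_perHardAlg`,
`algDescentAt_of_perHardAlg`): the open window of each wall is exactly lens 4's `[1/2, 1]`.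
[cite: LimayeSrinivasanTavenas2025, Cor. 4] -/
theorem walls_belowHalf (p q : ℕ) (hpq : 2 * p < q) :
    AlgConstantLiftAt (fun n => p * Nat.log 2 (Nat.log 2 (Nat.log 2 n)) / q) ∧
      HeightLiftAt (fun n => p * Nat.log 2 (Nat.log 2 (Nat.log 2 n)) / q) ∧
      AlgDescentAt (fun n => p * Nat.log 2 (Nat.log 2 (Nat.log 2 n)) / q) :=
  ⟨fun _ => not_perEasyAlg_belowHalf p q hpq,
    heightLiftAt_of_perHardAlg _ (not_perEasyAlg_belowHalf p q hpq),
    algDescentAt_of_perHardAlg _ (not_perEasyAlg_belowHalf p q hpq)⟩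

end Summit.ValiantsHypothesis.ValiantsHypothesis.Theorems.SuccinctLift
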